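import Mathlib
import HarnessLib
import Summits.NavierStokesRegularity.NavierStokesRegularity.Theorems.UnthreadedDoorToroidalPotential
import Summits.NavierStokesRegularity.NavierStokesRegularity.Theorems.UnthreadedRigidityDoorWindowToroidalPotentialSmooth

/-!
# Route UnthreadedRigidityDoor · crux `UnthreadedRigidity` (stmt-NavierStokesRegularity-27585) · LINE «jet rigidity»
# (planner ns-idea-6 g5, birth skeleton sha16 `5d320f85a8de9ffc`) — the potential-half of
# `stub_windowPotentialLaw`: the TOROIDAL POTENTIAL of an unthreaded vorticity on an OPEN TIME WINDOW

Seat ns-qj-p1 g3 (director-ns KEY-NS #141: `stub_windowPotentialLaw` assembly), `--supports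
stmt-NavierStokesRegularity-27585 --as helper`. Open-window form (`S` open, `t ∈ S` in place of `t < 0`, and NO
bound on the vorticity — the 27585 stub does not ask for `|T| ≤ πK`) of ns-es-p1 g4's construction for crux 1222
(`UnthreadedDoorToroidalPotentialConstruction` / `UnthreadedDoorToroidalPotential`, window `(−∞,0)`); every
time-free ingredient (chart chords `pole_chord_ne_zero` / `pole_equator_chord_ne_zero` / `equator_chord_ne_zero` /
`coord_two_neg_of_not_mem`, the chain rule `hasFDerivAt_comp_norm_self`, the Poincaré primitive
`exists_primitive_pullbackForm`, the chord identity `integral_inner_chord_eq_sub`, `eq_zero_of_sphere_tangent`,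
`sum_fderiv_curl_apply_eq_zero`, `cross_cross_self`) is IMPORTED from es-p1's files, not restated.

* `exists_toroidalPotential_zero_of_isOpen` — for `Ω` jointly smooth on `S × ℝ³`, tangent to the spheres about
  `0`, divergence free off the origin: a scalar `T`, jointly `C^∞` on `S × (ℝ³ ∖ {0})`, `T(t, 0) = 0`, with
  `∇T(t)(x) = a x + ‖x‖⁻² (x × Ω(t, x))` (`x ≠ 0`) — chord integrals of the radial pull-back form in the two
  charts `{x₀ ≠ 0 ∨ x₁ ≠ 0 ∨ x₂ > 0}` / `{x₂ < 0}`, agreeing by path independence (es-p1's proof, `Iio 0 ↦ S`).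
* `exists_windowToroidalPotential_zero`, `exists_windowToroidalPotential` — **for a velocity `u` jointly
  smooth on `S × ℝ³` whose vorticity is tangent to every sphere about `x₀` (`⟪curl u(t) x, x − x₀⟫ = 0`), there
  is `T`, jointly `C^∞` on `S × (ℝ³ ∖ {x₀})`, with `curl u(t)(x) = ∇T(t)(x) × (x − x₀)` for all `t ∈ S` and
  ALL `x`** (the shape consumed by the `stub_windowPotentialLaw` assembly).

HONEST FRAMING: a kinematic representation for HYPOTHETICAL unthreaded window solutions (local blow-up profiles of
the door); nothing here bears on `UnthreadedRigidity`, the door Target, or Navier–Stokes regularity; no summit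
statement is proved. Credit: construction by ns-es-p1 g4 (design note `TOROIDAL-POTENTIAL-PLAN.md`, ns-qj-p1 g3);
this file only widens the time set and drops the bound. [folklore]

References: G. Backus, Rev. Geophys. 24 (1986) §2 (Mie / toroidal–poloidal representation).
-/

noncomputable section

open Set Filter Function Metric MeasureTheory intervalIntegral
open scoped Topology RealInnerProductSpace ContDiff

set_option linter.dupNamespace false

namespace Summit.NavierStokesRegularity.NavierStokesRegularity.Theorems.PoloidalLiouville

open Literature.Analysis.FluidPDE

/-! ## The construction, centre `0`, open time window -/

/-- **Open-window toroidal potential, centre `0`** (es-p1's `exists_toroidalPotential_zero` with `(−∞,0)` replaced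
by an open time set `S`): for `Ω` jointly smooth on `S × ℝ³`, tangent to the spheres about the origin and
divergence free off the origin, there is `T : ℝ → ℝ³ → ℝ`, jointly `C^∞` on `S × (ℝ³ ∖ {0})`, vanishing on the
ray `{0}` of centres (`T(t,0) = 0`), whose slices have gradient `a x + ‖x‖⁻² (x × Ω(t,x))` at `x ≠ 0`, and which
on each sphere is a pole-normalised primitive of the pull-back form. [folklore] -/
theorem exists_toroidalPotential_zero_of_isOpen {S : Set ℝ} (hS : IsOpen S)
    {Ω : ℝ → EuclideanSpace ℝ (Fin 3) → EuclideanSpace ℝ (Fin 3)}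
    (hΩ : ContDiffOn ℝ ∞ (uncurry Ω) (S ×ˢ univ))
    (htan : ∀ t ∈ S, ∀ y, ⟪y, Ω t y⟫ = 0)
    (hdiv : ∀ t ∈ S, ∀ p : EuclideanSpace ℝ (Fin 3), p ≠ 0 →
      ∑ i, fderiv ℝ (Ω t) p (EuclideanSpace.single i 1) i = 0) :
    ∃ T : ℝ → EuclideanSpace ℝ (Fin 3) → ℝ,
      ContDiffOn ℝ ∞ (uncurry T) (S ×ˢ {0}ᶜ) ∧
      (∀ t, T t 0 = 0) ∧
      (∀ t ∈ S, ∀ x : EuclideanSpace ℝ (Fin 3), x ≠ 0 → ∃ a : ℝ,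
        HasFDerivAt (T t) (innerSL ℝ (a • x + (‖x‖ ^ 2)⁻¹ • cross x (Ω t x))) x) ∧
      (∀ t ∈ S, ∀ r : ℝ, 0 < r → ∃ Φ : EuclideanSpace ℝ (Fin 3) → ℝ,
        (∀ z : EuclideanSpace ℝ (Fin 3), z ≠ 0 →
          HasFDerivAt Φ (innerSL ℝ ((‖z‖ ^ 2)⁻¹ • cross z (Ω t ((r / ‖z‖) • z)))) z) ∧
        ∀ x : EuclideanSpace ℝ (Fin 3), x ≠ 0 → ‖x‖ = r →
          T t x = Φ x - Φ (r • EuclideanSpace.single 2 1)) := by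
  classical
  set e₃ : EuclideanSpace ℝ (Fin 3) := EuclideanSpace.single 2 1 with he₃
  set e₁ : EuclideanSpace ℝ (Fin 3) := EuclideanSpace.single 0 1 with he₁
  set G : ℝ → ℝ → EuclideanSpace ℝ (Fin 3) → EuclideanSpace ℝ (Fin 3) :=
    fun t r z => (‖z‖ ^ 2)⁻¹ • cross z (Ω t ((r / ‖z‖) • z)) with hG
  set C : ℝ → ℝ → EuclideanSpace ℝ (Fin 3) → EuclideanSpace ℝ (Fin 3) → ℝ :=
    fun t r p q => ∫ s in (0 : ℝ)..1, ⟪G t r (p + s • (q - p)), q - p⟫ with hC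
  set Φp : ℝ → ℝ → EuclideanSpace ℝ (Fin 3) → ℝ := fun t r x => C t r (r • e₃) x with hΦp
  set Φm : ℝ → ℝ → EuclideanSpace ℝ (Fin 3) → ℝ :=
    fun t r x => C t r (r • e₃) (r • e₁) + C t r (r • e₁) x with hΦm
  set Op : Set (EuclideanSpace ℝ (Fin 3)) := {x | x 0 ≠ 0 ∨ x 1 ≠ 0 ∨ 0 < x 2} with hOp
  set Tf : ℝ → ℝ → EuclideanSpace ℝ (Fin 3) → ℝ :=
    fun t r x => if x ∈ Op then Φp t r x else if x 2 < 0 then Φm t r x else 0 with hTf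
  -- openness of the charts
  have hc : ∀ i : Fin 3, Continuous fun x : EuclideanSpace ℝ (Fin 3) => x i := fun i =>
    (EuclideanSpace.proj i).continuous
  have hOp_open : IsOpen Op :=
    ((isOpen_ne.preimage (hc 0)).union ((isOpen_ne.preimage (hc 1)).union
      (isOpen_lt continuous_const (hc 2))))
  have hOm_open : IsOpen {x : EuclideanSpace ℝ (Fin 3) | x 2 < 0} := isOpen_lt (hc 2) continuous_const
  -- slices, continuity of `G`, primitives, chord identities
  have hΩ' : IsSmoothSpaceTimeOn S Ω := hΩ
  have hslice : ∀ t ∈ S, ContDiff ℝ ∞ (Ω t) := fun t ht => hΩ'.contDiff_slice ht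
  have hGcont : ∀ t ∈ S, ∀ r, ContinuousOn (G t r) {z | z ≠ 0} := fun t ht r z hz =>
    (contDiffAt_pullbackForm (hslice t ht) r hz).continuousAt.continuousWithinAt
  have hprim : ∀ t ∈ S, ∀ r : ℝ, 0 < r → ∃ Φ : EuclideanSpace ℝ (Fin 3) → ℝ,
      ∀ z : EuclideanSpace ℝ (Fin 3), z ≠ 0 → HasFDerivAt Φ (innerSL ℝ (G t r z)) z :=
    fun t ht r hr => exists_primitive_pullbackForm (hslice t ht) (htan t ht) (hdiv t ht) hr.ne'
  have hchordp : ∀ t ∈ S, ∀ r : ℝ, 0 < r → ∀ Φ : EuclideanSpace ℝ (Fin 3) → ℝ,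
      (∀ z : EuclideanSpace ℝ (Fin 3), z ≠ 0 → HasFDerivAt Φ (innerSL ℝ (G t r z)) z) →
      ∀ x ∈ Op, Φp t r x = Φ x - Φ (r • e₃) := fun t ht r hr Φ hΦ x hx =>
    integral_inner_chord_eq_sub (S := {z | z ≠ 0}) hΦ (hGcont t ht r)
      (fun s hs => pole_chord_ne_zero hr hx hs)
  have hchordm : ∀ t ∈ S, ∀ r : ℝ, 0 < r → ∀ Φ : EuclideanSpace ℝ (Fin 3) → ℝ,
      (∀ z : EuclideanSpace ℝ (Fin 3), z ≠ 0 → HasFDerivAt Φ (innerSL ℝ (G t r z)) z) →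
      ∀ x : EuclideanSpace ℝ (Fin 3), x 2 < 0 → Φm t r x = Φ x - Φ (r • e₃) := by
    intro t ht r hr Φ hΦ x hx
    have h1 : C t r (r • e₃) (r • e₁) = Φ (r • e₁) - Φ (r • e₃) :=
      integral_inner_chord_eq_sub (S := {z | z ≠ 0}) hΦ (hGcont t ht r)
        (fun s _ => pole_equator_chord_ne_zero hr s)
    have h2 : C t r (r • e₁) x = Φ x - Φ (r • e₁) :=
      integral_inner_chord_eq_sub (S := {z | z ≠ 0}) hΦ (hGcont t ht r)
        (fun s _ => equator_chord_ne_zero hr hx s)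
    simp only [hΦm, h1, h2]
    ring
  have hTf_repr : ∀ t ∈ S, ∀ r : ℝ, 0 < r → ∀ Φ : EuclideanSpace ℝ (Fin 3) → ℝ,
      (∀ z : EuclideanSpace ℝ (Fin 3), z ≠ 0 → HasFDerivAt Φ (innerSL ℝ (G t r z)) z) →
      ∀ x : EuclideanSpace ℝ (Fin 3), x ≠ 0 → Tf t r x = Φ x - Φ (r • e₃) := by
    intro t ht r hr Φ hΦ x hx
    by_cases hxO : x ∈ Op
    · simp only [hTf, if_pos hxO]; exact hchordp t ht r hr Φ hΦ x hxO
    · have hx2 : x 2 < 0 := coord_two_neg_of_not_mem hx hxO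
      simp only [hTf, if_neg hxO, if_pos hx2]; exact hchordm t ht r hr Φ hΦ x hx2
  have hagree : ∀ t ∈ S, ∀ r : ℝ, 0 < r → ∀ x : EuclideanSpace ℝ (Fin 3), x 2 < 0 →
      Tf t r x = Φm t r x := by
    intro t ht r hr x hx2
    obtain ⟨Φ, hΦ⟩ := hprim t ht r hr
    have hx : x ≠ 0 := fun h => by rw [h] at hx2; simp at hx2
    rw [hTf_repr t ht r hr Φ hΦ x hx, hchordm t ht r hr Φ hΦ x hx2]
  -- joint smoothness of the two chart formulas
  have hVp : IsOpen {q : ℝ × ℝ × EuclideanSpace ℝ (Fin 3) | q.1 ∈ S ∧ 0 < q.2.1 ∧ q.2.2 ∈ Op} :=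
    (hS.preimage continuous_fst).inter
      ((isOpen_lt continuous_const (continuous_fst.comp continuous_snd)).inter
        (hOp_open.preimage (continuous_snd.comp continuous_snd)))
  have hVm : IsOpen {q : ℝ × ℝ × EuclideanSpace ℝ (Fin 3) | q.1 ∈ S ∧ 0 < q.2.1 ∧ q.2.2 2 < 0} :=
    (hS.preimage continuous_fst).inter
      ((isOpen_lt continuous_const (continuous_fst.comp continuous_snd)).inter
        (hOm_open.preimage (continuous_snd.comp continuous_snd)))
  have hΦp_smooth : ContDiffOn ℝ ∞ (fun q : ℝ × ℝ × EuclideanSpace ℝ (Fin 3) => Φp q.1 q.2.1 q.2.2)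
      {q | q.1 ∈ S ∧ 0 < q.2.1 ∧ q.2.2 ∈ Op} :=
    contDiffOn_chordIntegral_of_isOpen hS hΩ (τ := fun q : ℝ × ℝ × EuclideanSpace ℝ (Fin 3) => q.1)
      (ρ := fun q => q.2.1) (A := fun q => q.2.1 • e₃) (B := fun q => q.2.2) contDiff_fst
      (contDiff_fst.comp contDiff_snd) ((contDiff_fst.comp contDiff_snd).smul contDiff_const)
      (contDiff_snd.comp contDiff_snd) hVp (fun q hq => hq.1)
      (fun q hq s hs => pole_chord_ne_zero hq.2.1 hq.2.2 hs)
  have hΦm_smooth : ContDiffOn ℝ ∞ (fun q : ℝ × ℝ × EuclideanSpace ℝ (Fin 3) => Φm q.1 q.2.1 q.2.2)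
      {q | q.1 ∈ S ∧ 0 < q.2.1 ∧ q.2.2 2 < 0} :=
    (contDiffOn_chordIntegral_of_isOpen hS hΩ (τ := fun q : ℝ × ℝ × EuclideanSpace ℝ (Fin 3) => q.1)
      (ρ := fun q => q.2.1) (A := fun q => q.2.1 • e₃) (B := fun q => q.2.1 • e₁) contDiff_fst
      (contDiff_fst.comp contDiff_snd) ((contDiff_fst.comp contDiff_snd).smul contDiff_const)
      ((contDiff_fst.comp contDiff_snd).smul contDiff_const) hVm (fun q hq => hq.1)
      (fun q hq s _ => pole_equator_chord_ne_zero hq.2.1 s)).add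
    (contDiffOn_chordIntegral_of_isOpen hS hΩ (τ := fun q : ℝ × ℝ × EuclideanSpace ℝ (Fin 3) => q.1)
      (ρ := fun q => q.2.1) (A := fun q => q.2.1 • e₁) (B := fun q => q.2.2) contDiff_fst
      (contDiff_fst.comp contDiff_snd) ((contDiff_fst.comp contDiff_snd).smul contDiff_const)
      (contDiff_snd.comp contDiff_snd) hVm (fun q hq => hq.1)
      (fun q hq s _ => equator_chord_ne_zero hq.2.1 hq.2.2 s))
  -- the map `(t, x) ↦ (t, ‖x‖, x)` and `(r, y) ↦ (t, r, y)`
  have hι : ∀ q : ℝ × EuclideanSpace ℝ (Fin 3), q.2 ≠ 0 →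
      ContDiffAt ℝ ∞ (fun q : ℝ × EuclideanSpace ℝ (Fin 3) => (q.1, ‖q.2‖, q.2)) q := fun q hq =>
    contDiffAt_fst.prodMk (((contDiffAt_norm ℝ hq).comp q contDiffAt_snd).prodMk contDiffAt_snd)
  refine ⟨fun t x => Tf t ‖x‖ x, ?_, ?_, ?_, ?_⟩
  · -- joint smoothness on the punctured slab
    rintro ⟨t, x⟩ ⟨ht, hx⟩
    have ht : t ∈ S := ht
    have hx : x ≠ 0 := hx
    have hxn : 0 < ‖x‖ := norm_pos_iff.2 hx
    refine ContDiffAt.contDiffWithinAt ?_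
    by_cases hxO : x ∈ Op
    · have hev : (uncurry fun t x => Tf t ‖x‖ x) =ᶠ[𝓝 (t, x)]
          fun q => (fun q' : ℝ × ℝ × EuclideanSpace ℝ (Fin 3) => Φp q'.1 q'.2.1 q'.2.2)
            (q.1, ‖q.2‖, q.2) := by
        filter_upwards [(hOp_open.preimage continuous_snd).mem_nhds (show (t, x).2 ∈ Op from hxO)]
          with q hq
        simp only [uncurry, hTf, if_pos (show q.2 ∈ Op from hq)]
      refine ContDiffAt.congr_of_eventuallyEq ?_ hev
      exact (hΦp_smooth.contDiffAt (hVp.mem_nhds ⟨ht, hxn, hxO⟩)).comp (t, x) (hι (t, x) hx)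
    · have hx2 : x 2 < 0 := coord_two_neg_of_not_mem hx hxO
      have hev : (uncurry fun t x => Tf t ‖x‖ x) =ᶠ[𝓝 (t, x)]
          fun q => (fun q' : ℝ × ℝ × EuclideanSpace ℝ (Fin 3) => Φm q'.1 q'.2.1 q'.2.2)
            (q.1, ‖q.2‖, q.2) := by
        filter_upwards [((hS.preimage continuous_fst).inter
          (hOm_open.preimage continuous_snd)).mem_nhds (show (t, x) ∈ _ from ⟨ht, hx2⟩)] with q hq
        have hq2 : q.2 ≠ 0 := fun h => by have := hq.2; simp [h] at this
        simp only [uncurry]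
        exact hagree q.1 hq.1 ‖q.2‖ (norm_pos_iff.2 hq2) q.2 hq.2
      refine ContDiffAt.congr_of_eventuallyEq ?_ hev
      exact (hΦm_smooth.contDiffAt (hVm.mem_nhds ⟨ht, hxn, hx2⟩)).comp (t, x) (hι (t, x) hx)
  · -- `T(t, 0) = 0`
    intro t
    have h0 : (0 : EuclideanSpace ℝ (Fin 3)) ∉ Op := by simp [hOp]
    simp only [hTf, if_neg h0]
    simp
  · -- the gradient of the slices
    intro t ht x hx
    have hxn : 0 < ‖x‖ := norm_pos_iff.2 hx
    obtain ⟨Φ, hΦ⟩ := hprim t ht ‖x‖ hxn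
    have hGx : G t ‖x‖ x = (‖x‖ ^ 2)⁻¹ • cross x (Ω t x) := by
      simp only [hG, div_self hxn.ne', one_smul]
    have hιt : ∀ q : ℝ × EuclideanSpace ℝ (Fin 3),
        ContDiffAt ℝ ∞ (fun q : ℝ × EuclideanSpace ℝ (Fin 3) => (t, q.1, q.2)) q := fun q =>
      contDiffAt_const.prodMk (contDiffAt_fst.prodMk contDiffAt_snd)
    by_cases hxO : x ∈ Op
    · -- chart of the pole chord
      have hΨ : DifferentiableAt ℝ (fun q : ℝ × EuclideanSpace ℝ (Fin 3) => Φp t q.1 q.2) (‖x‖, x) :=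
        ((hΦp_smooth.contDiffAt (hVp.mem_nhds ⟨ht, hxn, hxO⟩)).comp (‖x‖, x) (hιt _)).differentiableAt
          (by simp)
      have hsl : HasFDerivAt (fun y => Φp t ‖x‖ y) (innerSL ℝ (G t ‖x‖ x)) x := by
        refine ((hΦ x hx).sub_const (Φ (‖x‖ • e₃))).congr_of_eventuallyEq ?_
        filter_upwards [hOp_open.mem_nhds hxO] with y hy
        exact hchordp t ht ‖x‖ hxn Φ hΦ y hy
      obtain ⟨a, ha⟩ := hasFDerivAt_comp_norm_self hx hΨ hsl
      refine ⟨a, ?_⟩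
      rw [← hGx]
      refine ha.congr_of_eventuallyEq ?_
      filter_upwards [hOp_open.mem_nhds hxO] with y hy
      simp only [hTf, if_pos hy]
    · -- chart of the equator chord
      have hx2 : x 2 < 0 := coord_two_neg_of_not_mem hx hxO
      have hΨ : DifferentiableAt ℝ (fun q : ℝ × EuclideanSpace ℝ (Fin 3) => Φm t q.1 q.2) (‖x‖, x) :=
        ((hΦm_smooth.contDiffAt (hVm.mem_nhds ⟨ht, hxn, hx2⟩)).comp (‖x‖, x) (hιt _)).differentiableAt
          (by simp)
      have hsl : HasFDerivAt (fun y => Φm t ‖x‖ y) (innerSL ℝ (G t ‖x‖ x)) x := by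
        refine ((hΦ x hx).sub_const (Φ (‖x‖ • e₃))).congr_of_eventuallyEq ?_
        filter_upwards [hOm_open.mem_nhds hx2] with y hy
        exact hchordm t ht ‖x‖ hxn Φ hΦ y hy
      obtain ⟨a, ha⟩ := hasFDerivAt_comp_norm_self hx hΨ hsl
      refine ⟨a, ?_⟩
      rw [← hGx]
      refine ha.congr_of_eventuallyEq ?_
      filter_upwards [hOm_open.mem_nhds hx2] with y hy
      have hy0 : y ≠ 0 := fun h => by rw [h] at hy; simp at hy
      exact hagree t ht ‖y‖ (norm_pos_iff.2 hy0) y hy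
  · -- sphere-wise representation by a primitive normalised at the pole
    intro t ht r hr
    obtain ⟨Φ, hΦ⟩ := hprim t ht r hr
    refine ⟨Φ, hΦ, fun x hx hxr => ?_⟩
    change Tf t ‖x‖ x = _
    rw [hxr]
    exact hTf_repr t ht r hr Φ hΦ x hx

/-! ## The representation `curl u = ∇T × (x − x₀)` on an open window (no bound) -/

/-- The vorticity `(t, x) ↦ curl u(t) x` of a velocity jointly smooth on `S × ℝ³` (`S` open) is jointly smooth
there (open-window form of es-p1's `contDiffOn_uncurry_curl`). [folklore] -/
theorem contDiffOn_uncurry_curl_of_isOpen {S : Set ℝ} (hS : IsOpen S)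
    {v : ℝ → EuclideanSpace ℝ (Fin 3) → EuclideanSpace ℝ (Fin 3)}
    (hv : ContDiffOn ℝ (⊤ : ℕ∞) (uncurry v) (S ×ˢ univ)) :
    ContDiffOn ℝ ∞ (uncurry fun t x => curl (v t) x) (S ×ˢ univ) := by
  have hv' : IsSmoothSpaceTimeOn S v := hv
  have hD : IsSmoothSpaceTimeOn S (fun t x => fderiv ℝ (v t) x) := hv'.fderiv_slice hS.uniqueDiffOn
  exact curlCLM.contDiff.comp_contDiffOn hD

/-- **Window toroidal potential, centre `0`, no bound.** If `v` is jointly smooth on `S × ℝ³` (`S` open) and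
`curl v(t)` is tangent to every sphere about the origin for `t ∈ S`, there is `T`, jointly smooth on
`S × (ℝ³ ∖ {0})`, with `curl v(t) x = ∇T(t)(x) × x` for all `t ∈ S` and all `x` (es-p1's `toroidalPotential_zero`
without the bound, `Iio 0 ↦ S`). [folklore] -/
theorem exists_windowToroidalPotential_zero {S : Set ℝ} (hS : IsOpen S)
    (v : ℝ → EuclideanSpace ℝ (Fin 3) → EuclideanSpace ℝ (Fin 3))
    (hv : ContDiffOn ℝ (⊤ : ℕ∞) (uncurry v) (S ×ˢ univ))
    (htan : ∀ t ∈ S, ∀ x, ⟪x, curl (v t) x⟫ = 0) :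
    ∃ T : ℝ → EuclideanSpace ℝ (Fin 3) → ℝ,
      ContDiffOn ℝ (⊤ : ℕ∞) (uncurry T) (S ×ˢ ({0}ᶜ : Set (EuclideanSpace ℝ (Fin 3)))) ∧
      ∀ t ∈ S, ∀ x, curl (v t) x = cross (gradient (T t) x) x := by
  have hv' : IsSmoothSpaceTimeOn S v := hv
  have hdiv : ∀ t ∈ S, ∀ p : EuclideanSpace ℝ (Fin 3), p ≠ 0 →
      ∑ i, fderiv ℝ (fun x => curl (v t) x) p (EuclideanSpace.single i 1) i = 0 := fun t ht p _ =>
    sum_fderiv_curl_apply_eq_zero ((hv'.contDiff_slice ht).of_le (by norm_cast)) p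
  obtain ⟨T, hTs, -, hTg, -⟩ := exists_toroidalPotential_zero_of_isOpen hS (Ω := fun t x => curl (v t) x)
    (contDiffOn_uncurry_curl_of_isOpen hS hv) htan hdiv
  refine ⟨T, hTs, fun t ht x => ?_⟩
  -- algebra of `cross` in the first argument (via the bilinear map `crossCLM`)
  have cross_zero_right' : ∀ a : EuclideanSpace ℝ (Fin 3), cross a 0 = 0 := fun a => by
    rw [← crossCLM_apply, map_zero]
  have cross_self_eq_zero : ∀ a : EuclideanSpace ℝ (Fin 3), cross a a = 0 := fun a => by
    simp [cross]
  have cross_smul_left_eq : ∀ (c : ℝ) (a b : EuclideanSpace ℝ (Fin 3)),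
      cross (c • a) b = c • cross a b := fun c a b => by
    rw [← crossCLM_apply, ← crossCLM_apply, map_smul, smul_apply]
  have cross_smul_add_left : ∀ (a : ℝ) (x b y : EuclideanSpace ℝ (Fin 3)),
      cross (a • x + b) y = a • cross x y + cross b y := fun a x b y => by
    rw [← crossCLM_apply, ← crossCLM_apply, ← crossCLM_apply, map_add, map_smul]; rfl
  by_cases hx : x = 0
  · rw [hx, cross_zero_right']
    exact eq_zero_of_sphere_tangent
      ((contDiff_curl (n := 0) ((hv'.contDiff_slice ht).of_le (by norm_cast))).continuous) (htan t ht)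
  obtain ⟨a, ha⟩ := hTg t ht x hx
  have hg : gradient (T t) x = a • x + (‖x‖ ^ 2)⁻¹ • cross x (curl (v t) x) := by
    refine HasGradientAt.gradient ?_
    rw [hasGradientAt_iff_hasFDerivAt]
    have hd : (InnerProductSpace.toDual ℝ (EuclideanSpace ℝ (Fin 3))
        (a • x + (‖x‖ ^ 2)⁻¹ • cross x (curl (v t) x)) : EuclideanSpace ℝ (Fin 3) →L[ℝ] ℝ) =
        innerSL ℝ (a • x + (‖x‖ ^ 2)⁻¹ • cross x (curl (v t) x)) := by
      ext y
      simp [InnerProductSpace.toDual_apply_apply]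
    rw [hd]
    exact ha
  rw [hg, cross_smul_add_left, cross_self_eq_zero, smul_zero, zero_add, cross_smul_left_eq,
    cross_cross_self, htan t ht x, zero_smul, sub_zero, smul_smul,
    inv_mul_cancel₀ (pow_ne_zero _ (norm_ne_zero_iff.2 hx)), one_smul]

/-- **Window toroidal potential, general centre** (the shape consumed by the assembly of 27585's
`stub_windowPotentialLaw`): if `u` is jointly `C^∞` on `S × ℝ³` (`S` open) and its vorticity is tangent to every
sphere about `x₀` for `t ∈ S` (`⟪curl u(t) x, x − x₀⟫ = 0` — the door's «unthreaded» hypothesis), there is a scalar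
`T`, jointly `C^∞` on `S × (ℝ³ ∖ {x₀})`, with `curl u(t)(x) = ∇T(t)(x) × (x − x₀)` for all `t ∈ S` and ALL `x`.
Translate to `x₀ = 0` and apply `exists_windowToroidalPotential_zero`.
[cite: Backus1986, §2 (Mie representation of solenoidal fields tangent to spheres)] -/
theorem exists_windowToroidalPotential {S : Set ℝ} (hS : IsOpen S)
    {u : ℝ → EuclideanSpace ℝ (Fin 3) → EuclideanSpace ℝ (Fin 3)} {x₀ : EuclideanSpace ℝ (Fin 3)}
    (hu : IsSmoothSpaceTimeOn S u)
    (hunthr : ∀ t ∈ S, ∀ x, ⟪curl (u t) x, x - x₀⟫ = 0) :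
    ∃ T : ℝ → EuclideanSpace ℝ (Fin 3) → ℝ,
      ContDiffOn ℝ (⊤ : ℕ∞) (uncurry T) (S ×ˢ ({x₀}ᶜ : Set (EuclideanSpace ℝ (Fin 3)))) ∧
      ∀ t ∈ S, ∀ x, curl (u t) x = cross (gradient (T t) x) (x - x₀) := by
  have hv : ContDiffOn ℝ (⊤ : ℕ∞) (uncurry u) (S ×ˢ univ) := hu
  set w : ℝ → EuclideanSpace ℝ (Fin 3) → EuclideanSpace ℝ (Fin 3) := fun t z => u t (z + x₀) with hw
  have hwv : ContDiffOn ℝ (⊤ : ℕ∞) (uncurry w) (S ×ˢ univ) :=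
    hv.comp (contDiff_fst.prodMk (contDiff_snd.add contDiff_const)).contDiffOn
      (fun q hq => ⟨hq.1, mem_univ _⟩)
  have hcurl : ∀ t z, curl (w t) z = curl (u t) (z + x₀) := fun t z => by
    simp only [curl_eq_curlCLM, hw, fderiv_comp_add_right]
  obtain ⟨T, hTs, hTc⟩ := exists_windowToroidalPotential_zero hS w hwv
    (fun t ht z => by rw [hcurl, real_inner_comm]; simpa using hunthr t ht (z + x₀))
  refine ⟨fun t x => T t (x - x₀), ?_, fun t ht x => ?_⟩
  · refine hTs.comp (contDiff_fst.prodMk (contDiff_snd.sub contDiff_const)).contDiffOn ?_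
    rintro ⟨t, x⟩ ⟨ht, hx⟩
    refine ⟨ht, ?_⟩
    simp only [mem_compl_iff, mem_singleton_iff] at hx ⊢
    exact sub_ne_zero.2 hx
  · have hg : gradient (fun x => T t (x - x₀)) x = gradient (T t) (x - x₀) := by
      simp only [gradient, sub_eq_add_neg, fderiv_comp_add_right]
    have h1 := hTc t ht (x - x₀)
    rw [hcurl, sub_add_cancel] at h1
    show curl (u t) x = cross (gradient (fun x => T t (x - x₀)) x) (x - x₀)
    rw [hg]
    exact h1

end Summit.NavierStokesRegularity.NavierStokesRegularity.Theorems.PoloidalLiouville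

end
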